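import Literature.MathematicalPhysics.QuantumFieldTheory.Balaban1983to89.B16Sect1Statements
import Literature.MathematicalPhysics.QuantumFieldTheory.Balaban1983to89.B16Sect1AnalyticExt
import Literature.MathematicalPhysics.QuantumFieldTheory.Balaban1983to89.B16Sect1WilsonTerms
import Literature.MathematicalPhysics.QuantumFieldTheory.Balaban1983to89.B16Eq165Descent
import Literature.MathematicalPhysics.QuantumFieldTheory.Balaban1983to89.B16Eq170Assembly
import Literature.MathematicalPhysics.QuantumFieldTheory.Balaban1983to89.B16Cor3Ops
import Literature.MathematicalPhysics.QuantumFieldTheory.Balaban1983to89.B15BasicStep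

/-!
# `Balaban1983to89.B16Carve39ExponentiationRHyp` — [Balaban1989LargeFieldII] pp. 367–379 [PDF 13–25] (Sect. 1, displays
# (1.40)–(1.72): exponentiation of the analytic extension, the constant `𝐂_k` p. 369, the expansions (1.50)–(1.58), the
# localizations (1.59)–(1.69), the new action `A′_k` p. 377, (1.70), `E_k(Z)` and the two classes p. 378, `𝐓′_k(X)` (1.71),
# THE 𝐑-OPERATION (1.72) p. 379): THE HYPOTHESIS-FORM BUNDLE OF CARVING BLOCK 39, with the block's residual printed
# sentences typed in hypothesis form and every in-tree statement of the block CITED BY NAME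

statement-level skeleton of published theorems with citation tags; proofs where landed; nothing here is a claim about the Yang–Mills mass gap

SOURCE.  T. Bałaban, *Large field renormalization. II. Localization, exponentiation, and bounds for the 𝐑 operation*,
Commun. Math. Phys. **122** (1989) 355–392, doi:10.1007/bf01238433 [Balaban1989LargeFieldII] (cell paper "B16"; held
`paper:balaban1989-cmp122-large-field-ii`, journal page = PDF page + 354; [IV] = [Balaban1989LargeFieldI], [III] =
[Balaban1988Convergent], [I] = [Balaban1987RG1], [15] = [Balaban1985Variational], [13] = [Balaban1985BackgroundPropagators],
[12] = [Balaban1985Averaging]).  Pages 366–379 were READ AS IMAGES for this file on the renders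
`run/shared/lean/pub/pub-balaban/b2b-balaban-ref1/pages/1989-cmp122-large-field-II/…-p012-x2.png` … `…-p025-x2.png`
(the text layer garbles every display).  STATUS of the source: published, refereed; a manuscript UNDER AUDIT by the cell
`pub-balaban` (0∕13 main theorems of the series are proved in the tree) — NOTHING printed is asserted below.

WHY THIS FILE (cell `lit-balaban`, P6 CARVING FAN of D-0154 (3b); seat `lit-balaban-carve-06` g6 carving BLOCK 39 under the
cell lead's RULING #7, `run/shared/lean/pub/lit-balaban/carve/STATUS.md` 2026-08-28T06:52:11Z; block row 39 of
`carve/BLOCKS-31-40.md` v1.1, rules `carve/CARVE-RULES.md`; KEY item `stmt-QuantumFields-20542` (K1⁷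
`StabilityBAtRecordR13SepCoPH`, DAG n05–n13), also-feeds `stmt-QuantumFields-20544`, `stmt-QuantumFields-20541`).  The
block is pp. 367–379 = displays (1.40)–(1.72) and the unnumbered statements among them.  At statement level this stretch
is IN THE TREE (cell SKELETON v3.365: 38 rows — proved 16, typed 15, typed-existing 7; 310 declarations in 43 modules cite
a locator in the range) — so, by the fan's rule «IN TREE = CITE, NEVER RESTATE», this file (a) RESTATES NOTHING: every
printed statement of the block that has a declaration is cited BY NAME (table below; the typed `Prop`s are USED by name
as fields of the bundle, the data `def`s and the PROVED theorems are cited), (b) types, in hypothesis form and in the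
tree's own vocabulary (`B16Sect1AnalyticExt.ExtData`, `B16Sect1Backgrounds.Sect1Data`, `B16.RelDomainSys`, the scalar
letter convention of `B16Sect1Statements`, the [IV] shapes `B15.BasicStep.Ineq183∕184∕187`), the TEN asserting
sentences of the block that had no declaration (§1; census below), and (c) conjoins the block's printed statements, by
name and in page order, into ONE hypothesis bundle `Hyp` over ONE record of explicit carriers `Letters` (§2), with a few
kernel-checked deliveries a consumer wants (§3).  A node prover takes `(𝔩 : Letters …) (h : Hyp 𝔩)`.

## The block's SKELETON rows → the in-tree declarations this file CITES (never restates)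

| row | print | in tree (module `…Balaban1983to89.<stem>`) | used here |
|---|---|---|---|
| B16.Eq1.40 | (1.40) p. 367 | PROVED ⇔ its variational form: `B16Sect1AnalyticExt.eq140_iff` (instance of `B16Eq112.eq112_iff_eq113`); PROVED from the minimum of (1.39): `B16Eq139CriticalPoint.critical140_of_isMinOn`, `eq140_of_isMinOn`; the sentence after it («exactly one solution B′_Λ(B̃′) … analytic … (1.41)») PROVED in the tree's complex Banach model: `B16Ineq141Solution.exists_solution140`, `solution140_unique`, `exists_analytic_solution140`, `exactlyOne141` (real uniqueness `B16Eq139CriticalPoint.solution140_unique_real`, `lipschitz140_of_bounds`; the contraction scheme `B16Sect1Kernels.fixedPoint_twice_bound`) | cited (v1.1: the v1 hypothesis slot `Sol140Printed`∕`Hyp.sol140` RESTATED this proved sentence — referee check-4 M-c4-1 — and is withdrawn) |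
| B16.Eq1.41 | (1.41) p. 367 | `B16Sect1Statements.Ineq141` (+ `ineq141_of_twice`); PROVED for the solution: `B16Ineq141Solution.ineq141_of_solution`, `exactlyOne141` | cited |
| B16.Eq1.42 | (1.42) p. 367 | data `B16Sect1AnalyticExt.ExtData.VΛ142`; statement `ExtData.Eq142`; DISCHARGED in the model: `B16Eq139CriticalPoint.eq142_model`, `eq142_with138_of_unique` | field `Hyp.eq142` (the abstract-letter USE of the typed row) |
| B16.Eq1.43 | (1.43) p. 367 | data `ExtData.U0ext`, `U0real`; PROVED `ExtData.eq143`, `eq143_with138` (from the p. 366 factorisation `Fact138M` and (1.38) `Eq138`∕`with138` — block 38's rows); at the instance with `M̃ʲ` given its body: `B16Eq143TildeAverage.eq138_slice`, `eq143_slice`, `eq143_cover` | cited |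
| B16.Eq1.44 | (1.44) p. 367 | data `ExtData.Vt144`; statement `ExtData.Eq144`; PROVED at the instance: `B16Eq143TildeAverage.eq144_slice`, `eq144_cover`, `vt144_slice_apply` | field `Hyp.eq144` (abstract-letter USE) |
| B16.Eq1.45 | (1.45) p. 367 | `B16Sect1Statements.Ineq145` | field `Hyp.ineq145` |
| B16.Eq1.46 | (1.46) p. 368 | data `B16Sect1WilsonTerms.Sect1Data.msConj`, `msAd`, `cfgH2`, `expB146`, `arg146`, `datum146`; statement `B16Sect1WilsonTerms.Sect1Data.Repr146` | field `Hyp.repr146` |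
| B16.Eq1.47 | (1.47) p. 368 | `B16Sect1Statements.Ineq147` (+ `alphaEps_div_gsq`, `ineq147_lastStep`); first two lines `B16Ineq147Chain.Ineq147First` …; DERIVED from [15] (190): `B16Ineq147FirstFrom190.ineq147_of_ineq190`; counts `B16Ineq147Count261`, `B16Sect1BoxCounts` | field `Hyp.ineq147` |
| B16.Eq1.48 | (1.48) p. 368 | statement `B16Sect1WilsonTerms.Sect1Data.Eq148`; PROVED from (1.46): `eq148_of_repr146`; positivity `eq148_main_nonneg` (`B16Sect1Wilson.wilsonLoc_nonneg`) | field `Hyp.eq148`; §3 `Letters.eq148_main_nonneg` |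
| B16.Def@369 | `𝐂_k` p. 369 | `B16Sect1Statements.Ck369`, `abs_Ck369_le`, `abs_Ck369_le_of_bounds`; `B16Eq133NewDeterminingSet.Ck149_eq_Ck369` | cited (a definition and a proved bound are not hypotheses) |
| B16.Eq1.49 | (1.49) p. 369 | `B16Sect1Assembly.Ck149`, `bracket149`, `rhs149`; PROVED `B16Sect1Assembly.eq149` | cited |
| B16.Eq1.50 | (1.50) p. 370 | data `B16Sect1Backgrounds.Sect1Data.data150`, `cfg150`, `bg0k`; PROVED on bonds `B16Eq150VariableFields.eq150` | cited |
| B16.Eq1.51 | (1.51) p. 370 | shape `B16Sect1Backgrounds.IsRepr`; statement `Sect1Data.Repr151` | field `Hyp.repr151` |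
| B16.Eq1.52 | (1.52) p. 370 | data `Sect1Data.detB1`, `detB2` (`B15DeterminingSets.join214`); `B16Eq152JoinedDeterminingSets.with152`, `detB1_with152`, `disjoint_detB1_detB2_of` | cited |
| B16.Eq1.53 | (1.53) p. 370 | data `Sect1Data.dataU1`, `cfgU1`, `cfgU2`, `cfgU12`; `cfgU12_eqOn`, `B16Eq152JoinedDeterminingSets.cfgU12_eqOff` | cited; the regularity sentence typed §1 `Regular153U12Printed` (field `Hyp.reg153`) |
| B16.Eq1.54 | (1.54) p. 370 | statement `Sect1Data.Repr154` | field `Hyp.repr154` |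
| B16.Eq1.55 | (1.55) + the three unnumbered displays p. 371 | PROVED: `B16Eq155.eq155` (with `theta1_insertion_of_split` …) | cited |
| B16.Eq1.56 | (1.56) p. 371 | data `Sect1Data.cfgKΛ` | cited; the «(1.84) [IV] is satisfied for it» sentence typed §1 `Small184UkΛPrinted` (field `Hyp.small156`) |
| B16.Eq1.57 | (1.57) p. 371 | data `Sect1Data.dataU1'`, `arg157`; statements `Sect1Data.Eq157a`, `Repr157`; `msMul_msInv_self` | fields `Hyp.eq157a`, `Hyp.repr157` |
| B16.Eq1.58 | (1.58) p. 371 | data `Sect1Data.cfgK`, `arg158`; PROVED first member `eq158a`; statement `Repr158` | field `Hyp.repr158` |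
| B16.Eq1.59 | (1.59) p. 372 | statement `B16Sect1AnalyticExt.Sect1Data.Eq159`; PROVED from its inputs `eq159_of`; the count behind «for a given Y₀ … small»: `B16.MultiscaleCount.family_card`, `count_paid` | field `Hyp.eq159` (for every term and datum); §3 `Hyp.eq159_of_inputs`; the (2.42)-type bound sentence typed §1 `LocTerms372Printed` (field `Hyp.loc372`) |
| B16.Eq1.60 | (1.60) p. 372 | PROVED `B16Sect1Backgrounds.Sect1Data.eq160` (from (1.51) and `GaugeField.GaugeInvariant`) | §3 `Hyp.eq160` delivers it from `Hyp.repr151` |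
| B16.Eq1.61 | (1.61) p. 373 (printed «(1.161)») | data `B16Sect1AnalyticExt.Sect1Data.data161`; statements `Repro161`, `Repr161`; `repr161_of`, `repr_of_repro` | fields `Hyp.repro161`, `Hyp.repr161` |
| B16.Eq1.62 | (1.62) p. 373 | `data162`, `Repro162`, `Repr162`, `repr162_of` | fields `Hyp.repro162`, `Hyp.repr162` |
| B16.Eq1.63 | (1.63) p. 374 | `data163`, `Repro163`, `Repr163`, `repr163_of` | fields `Hyp.repro163`, `Hyp.repr163` |
| B16.Eq1.64 | (1.64) p. 374 | statement `Sect1Data.Eq164`; PROVED `eq164_of` | field `Hyp.eq164` |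
| B16.Eq1.65 | (1.65) p. 375 | `B16Eq165Descent.Eq165`, `Eq165At`, `Statement165`; PROVED uses: `mapsTo_dom_of_eq165`, `analyticOnNhd_comp_of_statement165`, `analyticOnNhd_sum_comp`, `eq165_iff_descends`; geometry `B16Stage3Regions` | fields `Hyp.stmt165`, `Hyp.dom165`; §3 `Hyp.analytic_term` |
| B16.Txt@376 | inductive decay factor p. 376 | PROVED arithmetic `B16Sect1Statements.ineq376_split` | cited |
| B16.Eq1.66 | (1.66) p. 376 | data `B16Sect1Statements.factor166`, `remaining166`; PROVED extraction under the geometric input `factor166_le_extract` | cited; the two sentences around it typed §1 `Factor166Printed`, `Extract166Printed` (fields `Hyp.factor166`, `Hyp.extract166`); §3 `extract166_of_geom` |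
| B16.Eq1.67 | (1.67) p. 376 | data `B16.RelDomainSys.dRel` (`dRel_nonneg`, `dRel_le`, `dRel_eq_of_not_meets`); continuum model `B14.RelTreeLength.relTreeLen`, `B16Ineq197RelGlue.relTreeLen_anti` | carrier of `Hyp.ineq168∕169`, `Hyp.exc376` |
| B16.Eq1.68 | (1.68) p. 377 | `B16.Ineq168` | field `Hyp.ineq168`; its «α arbitrarily small for γ small» clause typed §1 `Alpha168ClausePrinted` (field `Hyp.alpha168`) |
| B16.Eq1.69 | (1.69) p. 377 | `B16.Ineq169` | field `Hyp.ineq169` |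
| B16.Def@377 | `A′_k` p. 377 | the letter `A'` of `B16Cor3.Repr1101` ((1.101)) and `Apk` of `B16Eq170Assembly.rhs170`; `B16Cor3Ops.Repr172.A'` | carrier (`Letters.Apk`, `Letters.R172`) |
| B16.Eq1.70 | (1.70) p. 377 | data `B16Eq170Assembly.bracket170`, `rhs170`; statement `Eq170`; PROVED from (1.49): `exponent149_eq_exponent170`, `rhs149_eq_rhs170`, `eq170_of_eq149` | field `Hyp.eq170` |
| B16.Def@378 | `E_k(Z)`, `M₀ := O(1)B₅M⁶`, the two classes p. 378 | letter `EkZ` of `bracket170`; set algebra `B16PostRGeom` (`LocalCollar.compl_enl4_inter`, `leading_support_eq`, `compl_newLambda_eq`); «equivalent, but not equal» `B16GaugeClassTransport` | cited; the small-field consequences and the `M₀` clause typed §1 `SmallField378Printed` (field `Hyp.smallField378`) |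
| B16.Eq1.71 | (1.71) pp. 378–379 | interface `B16Cor3Ops.PosOp` (`ofKernel`, `mulOp`, `sumOp`, `comp`, `abs_apply_le`); `B16.ineq173`–`ineq175` | carrier (inside `Letters.R172`) |
| B16.Eq1.72 | (1.72) p. 379 | term data `B16Cor3Ops.Repr172` (`term`, `Holds`, `fam_injective`, `abs_term_le`, `term_nonneg`, `uvIneq_of_repr172`) | field `Hyp.repr172` |
| B16.Lem@379 | `σ` small p. 379 | `B16Sect1Statements.SigmaQuad379`, `SigmaV379`; PROVED `sigmaQuad379_arith`, `sigmaQuad379_of_kernel`, `B16Sect1SmallFactors.sigmaQuad379_small` | fields `Hyp.sigmaQuad`, `Hyp.sigmaV`; §3 `Hyp.sigmaQuad_chain` |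

## Census of the REMAINING printed sentences of pp. 367–379 (every sentence that asserts something), with disposition
(l. = line of the printed page below the running head, displays counted)

* p. 367 l. 5–9 «The notation above is a bit simplified … the boundary effects at the boundary ∂Z are negligible» — a
  notational remark; no statement.  l. 9–11 «Eq. (1.40) has exactly one solution B′_Λ(B̃′), which is an analytic function of
  the 𝐠ᶜ-valued small field B̃′, satisfying the bound (1.41)» — PROVED in the tree (`B16Ineq141Solution.exactlyOne141`,
  `exists_analytic_solution140`, `solution140_unique`, `ineq141_of_solution`; (1.41) = `Ineq141`): cited (v1 typed it as a
  hypothesis slot `Sol140Printed` — a restatement, withdrawn in v1.1 on referee check-4's M-c4-1).  l. 14–17 «Existence of the analytic extension follows from the results of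
  Sect. G [15], and from the results and bounds formulated above» — a proof pointer; no new statement.  l. 22–24 «The
  representation and the bound hold on the jᵗʰ domain of the determining set 𝐁_k(Z), for j = 0, 1, …, k. They all hold on
  the domain Λ» — the DOMAIN clause of (1.44)–(1.45): carried by the quantifier `∀ j ≤ k` and the size functionals `devj j` of
  `Hyp.ineq145` (docstring).  l. 24–25 **«the field Mʲ(U₀(U)) is also small on Λ; it satisfies the bound (1.84) [IV], with
  α_{0,k} instead of ε_k»** — TYPED `Small184MjU0Printed` over `B15.BasicStep.Ineq184`.  l. 26–28 **«the function 𝐇_{k,Λ} in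
  the representation (1.86) [IV] has the analytic extension 𝐀₀ = 𝐇_{k,Λ}((1/i) log M˙(U₀(𝐔))) satisfying (1.87) [IV], with
  α_{0,k} + α_{1,k} instead of ε_k»** — TYPED `Ext187A0Printed` over `B15.BasicStep.Ineq187`.
* p. 368 l. 1–4 «all terms of the expansion corresponding to (1.17) are small by the exponential decay of the 𝐇-function,
  except the term A(…)» and l. 13–15 «Again, all the terms in this expansion are small, except the term A(…)» — qualitative
  («small» unquantified; the one quantified instance is (1.47) `Ineq147`, «Bounds for the other terms in the expansion are
  similar»): ABSORBED by `Hyp.ineq147` + `Hyp.eq148` (whose `O(1)` collects those terms, smallness letter `τ148`).  l. 5–8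
  (the datum of `U″_{k,Z″_{h+2}}`, «analytic function of 𝐀₀, hence of 𝐔») — `B16Sect1WilsonTerms.Sect1Data.cfgH2`∕`datum146`:
  cited.  l. 10–12 «The argument of the function 𝐇″_{h+2} has a support in the domain Ω″˜²_{h+1}∩Z″_{h+2}» — quoted in
  `Repr146` (the argument `arg146` is built from `Q̃˙(η𝐀₀)`, localized by (1.54)'s `msRestrict`): cited.  After (1.48): «the
  terms in O(1) are small, and depend analytically on the field 𝐔 restricted to the domain Z» — smallness letter `τ148` in
  `Hyp.eq148`; «The gauge field in the Wilson action on the right-hand side is G-valued, hence the action is positive» —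
  PROVED `eq148_main_nonneg`: cited (§3).  The closing paragraph of p. 368 (the cancellation problem dictates N) — commentary.
* p. 369 l. 1–11 (the new terms are localizable, small, boundary terms; «We denote the sum … by 𝐂_k») — `Ck369`,
  `abs_Ck369_le`: cited.  After (1.49): «𝐑_k is not complete yet … equal to 𝐑_{k−1} + 𝐑″^{(k)}» and «𝐁″_k is the sum of the
  new boundary terms created by the N preliminary integrations» — RECOLLECTIONS of [IV] §1 («Let us recall»): not this
  paper's statements, NOT typed.  The programme paragraph («Our problem now is to reconstruct …») — no statement.
* p. 370 after (1.50) «The determining set 𝐁″_k restricted to Λᶜ, and the field V″↾_{Λᶜ}, coincide with the corresponding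
  determining set, and the field, for the new configuration U_k» — quoted in `Sect1Data.cfg150`'s docstring, and the content
  of (1.33)–(1.35) (`B16Eq133NewDeterminingSet.detSetK133`, `Sect1Data.cfgK135`): cited.  «U⁰_k … considered on Zᶜ depends
  weakly on the field V″↾ …» — heuristic («weakly»), no statement.  After (1.53): **«[U_{1,2}] seems to be singular on a
  neighborhood of this boundary, but in fact it is regular, and satisfies the regularity conditions typical for an h-order
  configuration on the domain (Ω″_{h+1})ᶜ∩Ω″˜²_{h+1}»** — recorded as untyped by `Sect1Data.cfgU12`'s docstring (cell GAPS
  C-adv3-84): TYPED `Regular153U12Printed`.  After (1.54): «The second field is obviously localized in Z″_k∩Ω″˜²_{h+1}» —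
  the `msRestrict (Zppk ∩ ΩppT2)` inside `Repr154`: cited.  p. 370 l. −4 – p. 371 l. 14 (the equality G″_kQ*_{𝐁″_k} = 0 of
  [13], the criticality of J₁, the three unnumbered displays, (1.55)) — PROVED `B16Eq155.eq155` from the located hypotheses:
  cited.
* p. 371 after (1.55) «The expression on the right-hand side above has a good localization property, which yields the
  required exponential factors» — qualitative; its quantified form is the p. 376 factor sentence (typed there).  After (1.56):
  **«The field V_Λ^{(A)} is in the axial gauge in Λ, hence it is small inside Λ, and averages of U_{k,Λ} are also small there.
  More precisely the condition (1.84) [IV] is satisfied for it»** — TYPED `Small184UkΛPrinted`.  After (1.57): «The field in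
  the argument of the function 𝐇_{𝐁₁} has again a right localization, and the function is decaying exponentially off the
  domain Z″_k» — the localization is `Sect1Data.arg157`'s `msRestrict Zppk`; the decay is [15] Prop. 9 (190)
  (`B11.Prop9Printed`), not re-asserted here: cited.  «The sequence of the four formulas (1.51), (1.54), (1.57), and (1.58)
  yields the required expansion» — bookkeeping remark.
* p. 372 (the operations on the square bracket of (1.59): the (6.9)–(6.10) [I] expansion with σ₀, «The other terms in the
  expansion vanish, because of the localization of the field B», «The nonvanishing terms … can be estimated as in
  (6.24)–(6.29) [I]», «Terms 𝐑^{(j)}(X, U″_k) are considered in the same way», the resummation «almost exactly the same as the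
  one discussed in Sect. 6 [I]») — procedure BY REFERENCE to [I] = [Balaban1988RG2Cluster] §1 (cell DIVERGENCE D-T1), its
  count kernel-checked in `B16.MultiscaleCount`; the one asserting sentence with a definite shape, **«In effect, for a given
  Y₀ we obtain a term which is small, and satisfies the exponential bound (2.42) [III] in d_k(Y₀)»** together with «the above
  expressions are analytic functions of U⁰_k on Y₀ … The bounds mentioned above are satisfied for these analytically extended
  expressions» — TYPED `LocTerms372Printed` (analyticity carried by the domains `dom`, as in `B16.Ineq168`).
* p. 373 l. 1–12 (repeat with (1.54), (1.57), (1.58); «These are the desired terms we need to reconstruct the new action»)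
  — procedure; no statement.  After (1.61): «Y₁∖Y₁⁰ is a boundary layer at the boundary ∂Y₁, of the width 2M₁ at most» and
  «u⁰_k(x) is an analytic function of 𝐇″_k restricted to this block … given by the explicit formula (106) [12]» — the first is
  quoted in `Repr161` (geometry of the determining sets, `B16Stage3Regions`), the second is [12] (106): cited, not re-asserted.
* p. 374 l. 3–4 «[𝐇_{𝐁₁}] is small on the boundary layer, and it depends analytically on the field U_{k,Λ}» and p. 375 l. 1
  «𝐇_k(s(Y′₄)) on (Y₃⁰)ᶜ∩Y₃ is also very small» — «small» unquantified (the quantified decay is [15] (190)); their USE is the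
  δ-term of (1.66), typed below: NOT typed separately (would be this seat's numbers, not the paper's).  The remaining sentences
  of pp. 374–375 up to (1.65) describe the substitutions («regularity properties … almost the same as …») — heuristic
  comparisons made precise BY (1.65) itself («A precise description of the regularity properties is given by the following
  statement»): `Statement165`, field `Hyp.stmt165`.
* p. 375 after (1.65): «the space Ũ″ᶜ_k(Y₁, α̃₀, α̃₁) is contained in the analyticity domain of the term 𝐄(X) we consider,
  hence in the analyticity domains of all terms in the obtained effective action» — field `Hyp.dom165` (a plain inclusion,
  the hypothesis `hdom` of `B16Eq165Descent.mapsTo_dom_of_eq165`); «This implies the basic fact that the function 𝐄(X, U⁰_k)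
  is an analytic function of the variables (𝐔, 𝐉) on the space Ũᶜ_k(Y₄, α̃₀, α̃₁)» — PROVED
  `B16Eq165Descent.analyticOnNhd_comp_of_statement165`: delivered §3 `Hyp.analytic_term`.  «It is clear for terms of 𝐁″_k, by
  the inductive assumptions … also clear for all new terms … simple to see for all the old terms» — justification of
  `dom165`; no separate statement.
* p. 376 l. 2–6 (the inductive factor, two displayed inequalities) — PROVED `ineq376_split`: cited.  l. 7–8 «Every
  localization operation above yields, after the resummations connected with a fixed domain Y′_i, i = 2, 3, 4, the factor
  exp(−(κ₁ − 1)M^{−d}|Y′_i|)» and l. 8–11 «the exponential decay of the functions 𝐇″_k, 𝐇_{𝐁₁}, 𝐇_k and 𝐇(𝐁″_k(Y₁), ·)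
  yields the additional factor exp(−δd((Y₁⁰)ᶜ∩Y₁∩Y′_i, X))» — the two inputs whose product with the inductive factor IS the
  display (1.66); the asserting sentence **«Thus we obtain the following exponential factor for the term in the expansion,
  corresponding to domains Y′₂, Y′₃, Y′₄ with a nonempty union: (1.66)»** — TYPED `Factor166Printed` (the term is bounded by
  its non-exponential factors times `factor166`).  l. 15–19 «Y₄∖Z = (Y₀∖Z) ∪ ⋃_{i=2}^{4}(Y′_i∖Z) … we also have exponential
  factors connecting different components of Y₄∖Z» — the geometric input `hext` of `factor166_le_extract` (cell GAPS
  G-B16-05); **«The above considerations imply that we can extract the factor exp(−(1 + 3β)κd_{k,Z}(Y₄)) from the exponential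
  (1.66), and the following exponential remains: …»** — TYPED `Extract166Printed` (exactly the conclusion of
  `factor166_le_extract`; §3 `extract166_of_geom`).  The resummation order («We fix the domain Y = Y₄ …», sums over Y′_i, X,
  j, types; «discussed in Sects. 6, 7 [I], and in Sects. 2, 3 [III]») — procedure by reference.  **«Consider now the
  exceptional terms … If the last domain is nonempty, then d_k(Y₀) ≧ d_{k,Z}(Y₁) = d_{k,Z}(Y), and … The sum is bounded by a
  constant times the same exponential factor as before»** — TYPED `Exceptional376Printed`.
* p. 377 l. 1–6 «The sum of the remaining exceptional terms, and the sum of terms with the new localization domains equal to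
  a component of Z, satisfies a much worse bound, similar to the bound (2.48) [III] … localized in a component of Z» — its
  displayed form is (1.69) (`Hyp.ineq169`).  l. 6–13 (the last resummation; the domains Y with Y∩Z˜ a union of components;
  «We denote this expression by V(Y, U_k). It has an analytic extension V(Y, (𝐔, 𝐉)) defined on the space Ũᶜ_k(Y, α̃₀, α̃₁)»)
  — the carriers `S`, `dom`, `V` of `B16.Ineq168∕169`: cited.  (1.68)'s clause **«with a constant α, which can be chosen
  arbitrarily small for γ small enough»** — TYPED `Alpha168ClausePrinted`.  «Here {Γ⁰_j} denotes the old determining set» —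
  the letter `lfCubes` of `Ineq169`.  The paragraph before (1.70) (adding and subtracting the Z-meeting terms, «the obtained
  expressions satisfy the bounds (1.68), (1.69)», «Denote this action by A′_k») — the regrouping hypothesis `hres` of
  `B16Eq170Assembly.rhs149_eq_rhs170` and the letter `Apk`: cited; (1.70) itself is field `Hyp.eq170`.
* p. 378 l. 1–2 (definition of `E_k(Z)`) — the letter `EkZ` of `bracket170`: cited.  The decomposition of unity and the two
  classes — set algebra `B16PostRGeom`: cited.  **«The restrictions introduced by χ_k imply that |∂V_k − 1| < 2ε_k on the
  corresponding components of Z, and the bound (1.78) [IV] for the function V_Λ. These bounds and the axial gauge conditions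
  for V′_k = V_k(V_Λ)⁻¹ imply the bound (1.83) [IV] for V′_k, i.e., |V′_k − 1| < O(1)B₅M⁶ε_k … M₀ = O(1)B₅M⁶. This implies that
  the characteristic function χ is also equal to 1»** — TYPED `SmallField378Printed` over `B15.BasicStep.Ineq183`.  «These
  functions are gauge invariant, and the effective action is gauge invariant; therefore we can remove the gauge fixing
  δ-functions … by a reversed Faddeev–Popov procedure … equivalent, but not equal» — `B16GaugeClassTransport`: cited.  The
  definition of the new 𝐓-operation and (1.71) — `B16Cor3Ops.PosOp`: cited.
* p. 379 after (1.71)∕(1.72): «rT denotes the usual axial gauge tree graph … we take only the 2^d reflections … and the d!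
  permutations», «All the expressions in the above integral operation are localized in the domain X», «Ω_k is the new kᵗʰ
  domain defined by the determining set of the configuration U_k», «the terms V(Y, U_k) depend on the sequence {Ωᶜ_j, Z_j}
  restricted to the components of Z contained in Y», «the sum in the definition (1.71) acts also on the last exponential in
  (1.72)», «The sum in the last exponential does not include terms with localization domains equal to one of the components
  of Z˜» — DEFINITIONAL clauses of (1.71)–(1.72), recorded in `B16Cor3Ops.Repr172`'s docstring∕fields (`index_inj`, the
  operations acting on everything to their right) and `B16PostRGeom` (both readings of «the new kᵗʰ domain»): cited.  The
  σ-paragraph («we have to find bounds for the operation 𝐓′_k(X) … first order terms are already small … O(1)B₃²A₁²p₁²(g_k)|𝐁₀|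
  (α_{0,k} + α_{1,k}) < … Thus the operation 𝐓′_k(X) can be represented as the operation for a regular G-valued configuration U,
  with the additional small, and possible complex valued, term in the exponential») — `SigmaQuad379`, `SigmaV379`,
  `sigmaQuad379_arith`: fields `Hyp.sigmaQuad`, `Hyp.sigmaV`.  ((1.73) ff., p. 380, belong to block 40.)

RESULT OF THE CENSUS: ten printed sentences of the block without a declaration — typed in §1; everything else is cited.

## What is here
* §1 the ten residual printed statements, hypothesis-form `def …Printed … : Prop`, each over explicit carriers in the
  tree's vocabulary, each quoted verbatim with its locator.
* §2 `Letters` — ONE record of the explicit carriers∕letters the block's statements are written over (data, no claim; every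
  field documented by the printed object it stands for), and `Hyp` — ONE `Prop`-valued structure conjoining BY NAME, in page
  order, the block's typed statements (the table's «field» column) and §1's residuals.
* §3 kernel-checked bookkeeping out of the bundle, no statement asserted: `Letters.eq148_main_nonneg` (positivity of the
  main term of (1.48), over the letters alone), `Hyp.eq160` ((1.60) PROVED from the field `repr151`), `Hyp.eq159_of_inputs` ((1.59) re-derived from `repr151`
  and the printed inputs of `eq159_of` — so the field `eq159` is CONSISTENT with them), `Hyp.analytic_term` (p. 375's «basic
  fact» from `stmt165` + `dom165`), `Hyp.sigmaQuad_chain` (p. 379's second inequality from `sigmaQuad` by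
  `sigmaQuad379_arith`), `Hyp.ineq168_small` ((1.68) at this step with ANY prescribed `α`, from the clause `alpha168` once the
  run's γ is below `γ₀(α)`), and `extract166_of_geom` (§1's `Extract166Printed` IS the conclusion of `factor166_le_extract`).

v1.1 (2026-08-28, same seat; referee `carve/CHECK-4.md` § 2026-08-28T07:52:08Z): (i) M-c4-1 — v1's eleventh residual
`Sol140Printed` (p. 367 l. 9–11) and the field `Hyp.sol140` RESTATED as a hypothesis a sentence the tree PROVES
(`B16Ineq141Solution`, `B16Eq139CriticalPoint`); both are WITHDRAWN (with their then-unused `Letters` fields and the abstract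
spaces `E₁`, `F₁`; nothing in the tree referenced them) and the rows (1.40)–(1.44) now cite the proving modules
(`B16Ineq141Solution`, `B16Eq139CriticalPoint`, `B16Eq143TildeAverage`); (ii) N-c4-21 — the (1.68)∕(1.69)∕exceptional-term
fields are now stated at the member `i₀` of the γ-family the α-clause quantifies over (one set of carriers; §3
`Hyp.ineq168_small`); every other declaration is unchanged in statement.

## HONEST SCOPE — what is NOT claimed
Nothing of [Balaban1989LargeFieldII] is proved here and no `…Printed` statement is asserted: `Hyp` is a HYPOTHESIS bundle,
§1 are hypothesis-form statements, §3 is bookkeeping between typed shapes.  The carriers are the tree's SCHEMATIC ones (cell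
DIVERGENCE D-b02.8 «schematic typing»): wherever print bounds a norm of an object the tree carries only abstractly, the bound
is over a real LETTER or an explicit SIZE FUNCTIONAL supplied by the model (`Letters.szG`, `devj`, `nlog`, `a∕da∕dda`, …), as in
`B16Sect1Statements`; analyticity predicates of objects without a complex-manifold carrier in the tree are abstract
predicates supplied by the model (`IsAnalyticA0`, `RegH`), as `B9Carve06Thms31to34Hyp`'s `IsAnalyticExt`.
With the carriers chosen freely every conjunct is trivially satisfiable — the bundle earns its keep only at Bałaban's own
objects (the cell's uncommissioned (α)-instances).  The block's p. 366 inputs ((1.38) `ExtData.Eq138`, the factorisation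
`Fact138M`, (1.39) `Def139`) are block 38's rows and are NOT fields here (a consumer needing (1.43) feeds them to
`ExtData.eq143`).  No summit statement is proved by this file; it moves no node count; nothing continuum ∕ ℝ⁴ ∕ OS ∕ mass-gap ∕
Clay.  No `sorry`, no `instance`, no `notation`, no attribute manipulation.
-/

open Set

namespace Literature.MathematicalPhysics.QuantumFieldTheory.Balaban1983to89.B16Carve39ExponentiationRHyp

open B16Sect1Backgrounds B15DeterminingSets GaugeField

/-! ## §1  The block's residual printed statements (no declaration in the tree), hypothesis form, page order -/

section Residuals

/-! ### p. 367: the two [IV]-bounds restated «with α instead of ε_k» -/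

variable {P : Params} {G : Type*} [GaugeGroup G] {av : ∀ i, Averaging P i G} {𝔤 : Type*} [AddCommGroup 𝔤] [Module ℝ 𝔤]

/-- **p. 367 [PDF 13] l. 22–25** (render p013), verbatim: *«The representation and the bound hold on the jᵗʰ domain of the
determining set 𝐁_k(Z), for j = 0, 1, …, k. They all hold on the domain Λ, and the field Mʲ(U₀(U)) is also small on Λ; it
satisfies the bound (1.84) [IV], with α_{0,k} instead of ε_k.»* — [IV] (1.84) p. 197 is *«|Mʲ(U₀) − 1| < O(1)B₃B₅M⁶ε_k inside
Λ»* (`B15.BasicStep.Ineq184`); here for the field `Mʲ(U₀(U))` of (1.44) (`B16Sect1AnalyticExt.ExtData.U0real`, the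
un-extended configuration of the real part `U` of `𝐔 = U′U ∈ dom`), at every bond of Λ at scale `j ≤ k` (`Λbj j`, explicit),
through the model's size functional `szG` (= «|W − 1|» of a group element), with `α₀k = α_{0,k}` in place of `ε_k`.
Hypothesis form. [cite: Balaban1989LargeFieldII, p.367 (after (1.45)); Balaban1989LargeFieldI, (1.84) p.197] -/
def Small184MjU0Printed (E : B16Sect1AnalyticExt.ExtData P G av 𝔤) (Λbj : ∀ j, Set (PBond P j)) (szG : G → ℝ)
    (C B₃ B₅ M α₀k : ℝ) : Prop :=
  ∀ UU ∈ E.dom, ∀ j ≤ E.k, ∀ b ∈ Λbj j,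
    B15.BasicStep.Ineq184 (szG (Averaging.iter av j (E.U0real UU.2) b)) C B₃ B₅ M α₀k

/-- **p. 367 [PDF 13] l. 26–28** (render p013), verbatim: *«From the results of Sect. G [15] it follows again that the function
𝐇_{k,Λ} in the representation (1.86) [IV] has the analytic extension 𝐀₀ = 𝐇_{k,Λ}((1/i) log M˙(U₀(𝐔))) satisfying (1.87) [IV],
with α_{0,k} + α_{1,k} instead of ε_k.»* — [IV] (1.87) p. 197 is *«|𝔸₀|, |∇^η𝔸₀|, |∂^{η*}∂^η𝔸₀| < O(1)B₃²B₅M⁶ε_k on Z″_k»*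
(`B15.BasicStep.Ineq187`).  Carriers: the function `HkΛ = 𝐇_{k,Λ}` of [IV] (1.86) (explicit, as every representing function in
`B16Sect1Backgrounds`), the extended configuration `U₀(𝐔)` of (1.43) (`ExtData.U0ext`), its chart coordinates `(1/i) log M˙(·)`
(`B16Sect1Backgrounds.msILog E.ch ∘ B15DeterminingSets.avgFamily av`), the model's three size functionals `a`, `da`, `dda`
(the suprema over `Z″_k` of `|𝐀₀|`, `|∇^η𝐀₀|`, `|∂^{η*}∂^η𝐀₀|`) and analyticity predicate `IsAnalyticA0` of the map `𝐔 ↦ 𝐀₀`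
on the domain.  Hypothesis form. [cite: Balaban1989LargeFieldII, p.367 (after (1.45)); Balaban1989LargeFieldI, (1.86)-(1.87) p.197] -/
def Ext187A0Printed (E : B16Sect1AnalyticExt.ExtData P G av 𝔤) (HkΛ : MSVecField P 𝔤 → VecField P 0 𝔤)
    (a da dda : VecField P 0 𝔤 → ℝ)
    (IsAnalyticA0 : (GaugeField P 0 G × GaugeField P 0 G → VecField P 0 𝔤) →
      Set (GaugeField P 0 G × GaugeField P 0 G) → Prop)
    (C B₃ B₅ M α₀k α₁k : ℝ) : Prop :=
  IsAnalyticA0 (fun UU => HkΛ (msILog E.ch (avgFamily av (E.U0ext UU)))) E.dom ∧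
    ∀ UU ∈ E.dom,
      B15.BasicStep.Ineq187 (a (HkΛ (msILog E.ch (avgFamily av (E.U0ext UU)))))
        (da (HkΛ (msILog E.ch (avgFamily av (E.U0ext UU))))) (dda (HkΛ (msILog E.ch (avgFamily av (E.U0ext UU)))))
        C B₃ B₅ M (α₀k + α₁k)

/-! ### p. 370: the configuration `U_{1,2}` is regular -/

/-- **p. 370 [PDF 16], after (1.53)** (render p016), verbatim: *«In the configuration U_{1,2} the arguments are separated
completely across the boundary ∂Ω″˜_{h+1}. It seems to be singular on a neighborhood of this boundary, but in fact it is
regular, and satisfies the regularity conditions typical for an h-order configuration on the domain (Ω″_{h+1})ᶜ∩Ω″˜²_{h+1}. It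
is so, because the arguments of the corresponding functions are equal to 1 on this domain, and the exponential decay
properties enforce the additional regularity.»* — for the configuration `U_{1,2}` of (1.53)
(`B16Sect1Backgrounds.Sect1Data.cfgU12`, whose docstring records this clause as untyped, cell GAPS C-adv3-84) on the printed
domain `(Ω″_{h+1})ᶜ ∩ Ω″˜²_{h+1}` — the second factor is the datum `D.ΩppT2`, the first is an EXPLICIT argument `Ωpph1 = Ω″_{h+1}`
(`Sect1Data` carries `Ω″˜_{h+1} = ΩppT` and `Ω″˜²_{h+1} = ΩppT2`, not `Ω″_{h+1}`; a model reading the printed factor as the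
complement of the support `Ω″˜_{h+1}` of `U₁` passes `D.ΩppT`) — through the model's predicate `RegH X U` = «U satisfies the
regularity conditions typical for an h-order configuration on X» ([IV] (1.64)–(1.69) at n = h; the tree's `B15.ComplexSpaces`
clauses) — print fixes no more than that.  Hypothesis form. [cite: Balaban1989LargeFieldII, p.370 (after (1.53))] -/
def Regular153U12Printed (D : Sect1Data P G av 𝔤) (Ωpph1 : Set (Site P 0))
    (RegH : Set (Site P 0) → GaugeField P 0 G → Prop) : Prop :=
  RegH (Ωpph1ᶜ ∩ D.ΩppT2) D.cfgU12

/-! ### p. 371: (1.84) [IV] holds for `U_{k,Λ}` -/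

/-- **p. 371 [PDF 17], after (1.56)** (render p017), verbatim: *«The field V_Λ^{(A)} is in the axial gauge in Λ, hence it is
small inside Λ, and averages of U_{k,Λ} are also small there. More precisely the condition (1.84) [IV] is satisfied for it.»*
— [IV] (1.84) (`B15.BasicStep.Ineq184`, *«|Mʲ(U₀) − 1| < O(1)B₃B₅M⁶ε_k inside Λ»*) for the averages `Mʲ(U_{k,Λ})`
(`Averaging.iter av j D.cfgKΛ`, the configuration (1.56)) at the bonds `Λin j` «inside Λ» at every scale `j ≤ k`, through the
size functional `szG`.  Hypothesis form. [cite: Balaban1989LargeFieldII, p.371 (after (1.56)); Balaban1989LargeFieldI, (1.84) p.197] -/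
def Small184UkΛPrinted (D : Sect1Data P G av 𝔤) (Λin : ∀ j, Set (PBond P j)) (szG : G → ℝ)
    (C B₃ B₅ M εk : ℝ) : Prop :=
  ∀ j ≤ D.k, ∀ b ∈ Λin j, B15.BasicStep.Ineq184 (szG (Averaging.iter av j D.cfgKΛ b)) C B₃ B₅ M εk

/-! ### p. 372: the resummed localization terms at a final domain `Y₀` -/

/-- **p. 372 [PDF 18]** (render p018), verbatim: *«For a fixed domain Y₀ we resum all the expressions constructed above, and
having Y₀ as the final localization domain. … In effect, for a given Y₀ we obtain a term which is small, and satisfies the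
exponential bound (2.42) [III] in d_k(Y₀). We consider all these terms as boundary terms connected with corresponding
components of Z … Let us notice only that the above expressions are analytic functions of U⁰_k on Y₀ … The bounds mentioned
above are satisfied for these analytically extended expressions.»* — over the localization-domain carrier of the k-th
step (`LocDomainSys`, `dj = d_k`), the resummed term `T Y₀` as a function of the (complex) configuration on its analyticity
domain `dom Y₀` (the analyticity clause is carried by `dom`, as in `B16.Ineq168`), the SMALL constant `c` («a term which is
small») and the decay rate `κ` of (2.42) [III] ([Balaban1988Convergent] p. 261 [PDF 19], verbatim: *«(iv) it satisfies the
bound |𝐁^{(j)}(X, (𝐔, 𝐉), A, {S_i∩X})| ≦ B₀exp(−κd_j(X)). (2.42)»* — the tree's `Step.LFHyp` clause; here in the norm-letter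
convention of `B16.Ineq168`, with `d_k(Y₀)` as printed on p. 372).  Hypothesis form; the count behind
«small» is `B16.MultiscaleCount`, the renormalization of the marginal orders is invoked by name in print (cell GAPS
G-adv3-12). [cite: Balaban1989LargeFieldII, p.372 (after (1.60)); Balaban1988Convergent, (2.42) p.261] -/
def LocTerms372Printed (S : LocDomainSys) {Φ : Type*} (dom : S.Dom → Set Φ) (T : S.Dom → Φ → ℂ) (c κ : ℝ) : Prop :=
  ∀ Y₀, ∀ φ ∈ dom Y₀, ‖T Y₀ φ‖ ≤ c * Real.exp (-(κ * S.dj Y₀))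

/-! ### p. 376: the factor (1.66), its extraction, the exceptional terms -/

/-- **p. 376 [PDF 22], the sentence of (1.66)** (render p022), verbatim: *«Thus we obtain the follwing [sic] exponential factor
for the term in the expansion, corresponding to domains Y′₂, Y′₃, Y′₄ with a nonempty union: exp(−βκd_j(X) − (1 + 3β)d_k(Y₀) −
δd((Y₁⁰)ᶜ∩Y₁∩Y′_{i₀}, X) − Σ_{i=2}^{4}(κ₁ − 1)M^{−d}|Y′_i|), (1.66) where i₀ is the index of the first nonempty domain Y′_i.»* —
the term (value `T`) is bounded by its non-exponential factors `A` (p. 375 l. −3: *«the other factors, like the powers of Lʲη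
or α_{0,k} coming from the renormalization procedure, were discussed thoroughly before»*) times the factor (1.66)
(`B16Sect1Statements.factor166`, typed there with the `κ` print drops in the second term, slip D-b02.4), over its printed
letters (`djX = d_j(X)`, `dkY₀ = d_k(Y₀)`, `dist = d((Y₁⁰)ᶜ∩Y₁∩Y′_{i₀}, X)`, `vol i = |Y′_i|`, `Minvd = M^{−d}`).  Hypothesis
form. [cite: Balaban1989LargeFieldII, (1.66) p.376] -/
def Factor166Printed (T A β κ djX dkY₀ δ dist κ₁ Minvd : ℝ) (vol : ℕ → ℝ) : Prop :=
  abs T ≤ A * B16Sect1Statements.factor166 β κ djX dkY₀ δ dist κ₁ Minvd vol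

/-- **p. 376 [PDF 22], the extraction** (render p022), verbatim: *«The above considerations imply that we can extract the factor
exp(−(1 + 3β)κd_{k,Z}(Y₄)) from the exponential (1.66), and the following exponential remains: exp(−βκd_j(X) −
½δd((Y₁⁰)ᶜ∩Y₁∩Y′_{i₀}, X) − Σ_{i=2}^{4}½(κ₁ − 1)M^{−d}|Y′_i|).»* — the CONCLUSION as printed: `factor166 ≤
exp(−(1 + 3β)κd_{k,Z}(Y₄)) · remaining166` (`dkZ = d_{k,Z}(Y₄)`, the relative size (1.67), `B16.RelDomainSys.dRel`).  The tree
PROVES it from the geometric input the «above considerations» supply (`B16Sect1Statements.factor166_le_extract`, cell GAPS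
G-B16-05) — `extract166_of_geom` below; as a field of `Hyp` it is the printed claim itself.  Hypothesis form.
[cite: Balaban1989LargeFieldII, (1.66)-(1.67) p.376] -/
def Extract166Printed (β κ djX dkY₀ δ dist κ₁ Minvd dkZ : ℝ) (vol : ℕ → ℝ) : Prop :=
  B16Sect1Statements.factor166 β κ djX dkY₀ δ dist κ₁ Minvd vol ≤
    Real.exp (-((1 + 3 * β) * κ * dkZ)) * B16Sect1Statements.remaining166 β κ djX δ dist κ₁ Minvd vol

/-- **pp. 376–377 [PDF 22–23], the exceptional terms** (render p022), verbatim: *«Consider now the exceptional terms, for which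
all the domains Y′_i are empty. Then there are only the first two terms in the exponential (1.66), Y₁ = Y₄ = Y and Y₀∖Z = Y₁∖Z.
If the last domain is nonempty, then d_k(Y₀) ≧ d_{k,Z}(Y₁) = d_{k,Z}(Y), and we can still resum over all terms with domains X
such that Y₀∖Z is fixed and equal to Y∖Z. The sum is bounded by a constant times the same exponential factor as before.»* —
over the relative-size carrier `S` of (1.67) (`B16.RelDomainSys`: `dj = d_k`, `dRel = d_{k,Z}`), the model's relation
`SameOffZ Y₀ Y` = «Y₀∖Z = Y∖Z ≠ ∅» (the abstract `Dom` carries no point sets), the resummed exceptional sum `Texc Y` on its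
domain `dom Y`, the constant `c'` and the rates `β`, `κ`; two clauses: the geometric inequality, and the bound by «the same
exponential factor as before» = the extracted `exp(−(1 + 3β)κd_{k,Z}(Y))`.  Hypothesis form. [cite: Balaban1989LargeFieldII, pp.376-377 (after (1.67))] -/
def Exceptional376Printed (S : B16.RelDomainSys) (SameOffZ : S.Dom → S.Dom → Prop) {Φ : Type*}
    (dom : S.Dom → Set Φ) (Texc : S.Dom → Φ → ℂ) (c' β κ : ℝ) : Prop :=
  (∀ Y₀ Y, SameOffZ Y₀ Y → S.dRel Y ≤ S.dj Y₀) ∧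
    ∀ Y₀ Y, SameOffZ Y₀ Y → ∀ φ ∈ dom Y, ‖Texc Y φ‖ ≤ c' * Real.exp (-((1 + 3 * β) * κ * S.dRel Y))

/-! ### p. 377: the dependence clause of (1.68) -/

/-- **p. 377 [PDF 23], the clause of (1.68)** (render p023), verbatim: *«|V(Y,(𝐔,𝐉))| ≦ α exp(−(1 + 2β)κd_{k,Z}(Y)) (1.68) for
Y∖Z˜ ≠ ∅, with a constant α, which can be chosen arbitrarily small for γ small enough»* — the dependency clause of the
constant of `B16.Ineq168` (there a free letter): for every `α > 0` there is `γ₀ > 0` such that in every situation `i`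
governed by a coupling bound `γOf i ∈ ]0, γ₀]` (a run with couplings in `]0, γ]`, at any of its steps: index type `ι`, data
`S i`, `inside i`, `dom i`, `V i` of (1.68) per situation, one configuration carrier `Φ` for all of them — the model's
choice), (1.68) holds with that `α` (and the fixed `β`, `κ`).  `∃ γ₀` exactly where print puts it (after `∀ α`).
Hypothesis form. [cite: Balaban1989LargeFieldII, (1.68) p.377] -/
def Alpha168ClausePrinted {ι Φ : Type*} (γOf : ι → ℝ) (S : ι → B16.RelDomainSys) (inside : ∀ i, (S i).Dom → Prop)
    (dom : ∀ i, (S i).Dom → Set Φ) (V : ∀ i, (S i).Dom → Φ → ℂ) (β κ : ℝ) : Prop :=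
  ∀ α : ℝ, 0 < α → ∃ γ₀ : ℝ, 0 < γ₀ ∧
    ∀ i, 0 < γOf i → γOf i ≤ γ₀ → B16.Ineq168 (S i) (inside i) (dom i) (V i) α β κ

/-! ### p. 378: the small-field consequences on the first-class components and the constant `M₀` -/

/-- **p. 378 [PDF 24]** (render p024), verbatim: *«For the components with the first, small field function we can remove the
characteristic functions χ_{k,Λ}χ, because they are equal to 1. This is clear for χ_{k,Λ}. The restrictions introduced by χ_k
imply that |∂V_k − 1| < 2ε_k on the corresponding components of Z, and the bound (1.78) [IV] for the function V_Λ. These bounds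
and the axial gauge conditions for V′_k = V_k(V_Λ)⁻¹ imply the bound (1.83) [IV] for V′_k, i.e., |V′_k − 1| < O(1)B₅M⁶ε_k, by
the same reasoning as in the proof of Lemma 1 [14] (even a simpler one). The number M₀ in the definition (1.101) [IV] is not
fixed yet; we choose it as equal to the above bound, i.e., M₀ = O(1)B₅M⁶. This implies that the characteristic function χ is
also equal to 1.»* — for every component `X` of `Z` «with the first, small field function» (the model's predicate `FirstClass
X`, p. 378's `{X₁, …, X_n}`; set algebra `B16PostRGeom`), through the plaquette and bond deviations `pdev p = |∂V_k(p) − 1|`,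
`bdev b = |V′_k(b) − 1|` at scale `k` on the plaquettes `plaqs X` ∕ bonds `bonds X` of the component: the two printed
consequences (the second in the shape `B15.BasicStep.Ineq183` of [IV] (1.83)), and the printed CHOICE of the constant `M₀` of
[IV] (1.101) with the same `O(1) = C`.  Hypothesis form (the implications from the χ-restrictions are the paper's reasoning
«as in the proof of Lemma 1 [14]», not re-derived). [cite: Balaban1989LargeFieldII, p.378; Balaban1989LargeFieldI, (1.83) p.197] -/
def SmallField378Printed {Comp : Type*} (FirstClass : Comp → Prop) (k : ℕ) (plaqs : Comp → Set (Plaq P k))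
    (bonds : Comp → Set (PBond P k)) (pdev : Plaq P k → ℝ) (bdev : PBond P k → ℝ) (εk C B₅ M M₀ : ℝ) : Prop :=
  (∀ X, FirstClass X →
      (∀ p ∈ plaqs X, pdev p < 2 * εk) ∧ ∀ b ∈ bonds X, B15.BasicStep.Ineq183 (bdev b) C B₅ M εk) ∧
    M₀ = C * B₅ * M ^ 6

end Residuals

/-! ## §2  The carriers of the block and the bundle -/

/-- **THE EXPLICIT CARRIERS ∕ LETTERS OF BLOCK 39** (data, no claim): everything the block's typed statements are written over,
for ONE run at ONE step `k` and ONE large-field region `Z`, field by field (pages of [Balaban1989LargeFieldII]).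
pp. 366–367: `E` = the data of the analytic extension (1.38)–(1.44) (`B16Sect1AnalyticExt.ExtData`: `U(𝐁_k(Z),·)`, the chart,
`k`, `Q_k^{s*}`, the bonds of Λ, `V_Λ`, `M̃^k`, `V′_Λ`, the domain of pairs `𝐔 = U′U`); `d, M, B₃, B₅` = the dimension and the
constants of [IV]; `BΛ142` = `B̃′ ↦ B′_Λ(B̃′)` on the chart fields of (1.42) (the solution map of (1.40), whose existence,
uniqueness, analyticity and bound (1.41) are PROVED in `B16Ineq141Solution`); `Mtj j, UkZp` = `M̃ʲ`, `U′_{k,Z}(·,·)` of (1.44);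
`devj j, nlog, C145` = the size functionals «|Ṽ_{j,Z}(V′) − 1|» on the j-th domain of 𝐁_k(Z) ∕ on Λ and «|log V′|», the O(1) of
(1.45); `Λbj, szG, C184, α₀k, α₁k` (p. 367 l. 24–25); `HkΛ, a, da, dda, IsAnalyticA0, C187` (p. 367 l. 26–28).
pp. 368–374: `D` = the data of Sect. 1 (`B16Sect1Backgrounds.Sect1Data`); (1.46)–(1.48): `detPPZh2 = 𝐁″_k(Z″_{h+2})`, `Zpph2 =
Z″_{h+2}`, `Ad`, `Qt = Q̃˙`, `𝔸₀`, `H146 = 𝐇″_{h+2}`, `u146 = u″_{h+2}`, `domB` = the small fields `B` (support of `χ′`), `w148 =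
(1/(g″_k(·))²)ζ₁`, `O148 B` = «the terms in O(1)», `τ148` their size bound; (1.47): `T147 B` = the value of the most dangerous
term, `C147, A₀, C₁, p₀g, q₁g, Rk, Linv, N` its letters; (1.51): `dom151, H151 = 𝐇″_k, u151 = u″_k`; p. 370: `Ωpph1 = Ω″_{h+1}`, `RegH`; (1.54):
`H2, Gk, H1k, J12, u0k`; p. 371: `Λin, εk`; (1.57)–(1.58): `H157 = 𝐇_{𝐁₁}, u157 = u₁, H158 = 𝐇_k, u158 = u_{k,Λ}`; (1.59):
`T159` (the terms 𝐄^{(j)}(X, ·, z), 𝐑^{(j)}(X, ·) with X ⊂ Zᶜ, X ⊂ □˜² — the case of (1.59); the other terms use (1.60), PROVED),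
`Eterm t`, `detJbox t = 𝐁_j(□₀)`, `Qd = Q˙`; (1.61)–(1.63):
`detPPY1, Y1, Y10, W161, detB1Y2, Y2, Y20, W162, detKY3, Y3, Y30, W163`; (1.64): `Vk`.  p. 372: `S372, dom372, T372, c372,
κ372`.  p. 375: `U0k, S₄, S₁` of (1.65) on complex carriers `Φ₁ → Φ₂`, and `domE X` = the analyticity domain of the term
`X : TE`.  p. 376: the scalar letters of (1.66)–(1.67) for ONE term (`T166, A166, β, κ, djX, dkY₀, δ, dist, κ₁, Minvd, vol,
dkZ`); pp. 376–377: the γ-family `ιγ, γOf, Sγ, insideγ, domγ, Vγ` of situations (a run with couplings in `]0, γOf i]` at one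
of its steps, with its `𝐃_k`, `d_k`, `d_{k,Z}` = `Sγ i : B16.RelDomainSys`, its predicate «Y is a component of Z˜», its
analyticity domains and terms `V(Y, ·)`) and the member `i₀` = THIS run at THIS step, at which `SameOffZ, Texc, c'` (exceptional
terms), `α168` (the α of (1.68)), `lfCubes, C169` ((1.69)) live.  (1.70): the letters of
`B16Eq170Assembly.Eq170` (`pref, χh, A1, μV, AV, μN, App, Apk = A′_k, dg, σ₀, nBT, EkZ = E_k(Z), EkΛ, μNB, wN, Q121, Ah2, SV`).
p. 378: `FirstClass, plaqs, bonds, pdev, bdev, C183, M₀`.  (1.72): `R172` (term data over the configurations `Cfg` and domains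
`Dom`) and the density `Rρ = 𝐑ρ_k`.  p. 379: `σ₁, σ₂, C379, C379', A₁, p₁g, cardB₀ = |𝐁₀|, αsum = α_{0,k} + α_{1,k}, C₀,
q₀g` (the coupling `g_k` is `D.gk` throughout).  DATA read off print; nothing claimed. [cite: Balaban1989LargeFieldII, (1.40)-(1.72) pp.367-379 (the objects named there)] -/
structure Letters (P : Params) (G : Type*) [GaugeGroup G] (av : ∀ i, Averaging P i G) (𝔤 : Type*) [AddCommGroup 𝔤]
    [Module ℝ 𝔤] (𝕜 : Type*) [AddCommGroup 𝕜] (Φ₁ Φ₂ : Type*) [NormedAddCommGroup Φ₁] [NormedSpace ℂ Φ₁]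
    [NormedAddCommGroup Φ₂] [NormedSpace ℂ Φ₂] (Φ Cfg Dom ΩV ΩN ΩNB : Type*) [MeasurableSpace ΩV]
    [MeasurableSpace ΩN] [MeasurableSpace ΩNB] where
  /-- pp. 366–367: the data of (1.38)–(1.44) -/
  E : B16Sect1AnalyticExt.ExtData P G av 𝔤
  /-- the dimension and the constants of [IV] appearing in (1.45), (1.83)–(1.87), p. 379 -/
  d : ℕ
  (M B₃ B₅ : ℝ)
  /-- (1.42): `B̃′ ↦ B′_Λ(B̃′)` on the chart fields -/
  BΛ142 : VecField P E.k 𝔤 → VecField P E.k 𝔤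
  /-- (1.44): `M̃ʲ`, `U′_{k,Z}(·,·)` -/
  Mtj : ∀ j, GaugeField P 0 G → GaugeField P j G
  UkZp : GaugeField P E.k G → GaugeField P E.k G → GaugeField P 0 G
  /-- (1.45): size functionals and the O(1) -/
  devj : ∀ j, GaugeField P j G → ℝ
  nlog : GaugeField P E.k G → ℝ
  C145 : ℝ
  /-- p. 367 l. 24–25 -/
  Λbj : ∀ j, Set (PBond P j)
  szG : G → ℝ
  (C184 α₀k α₁k : ℝ)
  /-- p. 367 l. 26–28 -/
  HkΛ : MSVecField P 𝔤 → VecField P 0 𝔤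
  (a da dda : VecField P 0 𝔤 → ℝ)
  IsAnalyticA0 : (GaugeField P 0 G × GaugeField P 0 G → VecField P 0 𝔤) →
    Set (GaugeField P 0 G × GaugeField P 0 G) → Prop
  C187 : ℝ
  /-- pp. 368–374: the data of Sect. 1 -/
  D : Sect1Data P G av 𝔤
  /-- (1.46)–(1.48) -/
  detPPZh2 : DetSet P
  Zpph2 : Set (Site P 0)
  Ad : G → 𝔤 →ₗ[ℝ] 𝔤
  Qt : VecField P 0 𝔤 → MSVecField P 𝔤
  𝔸₀ : VecField P 0 𝔤
  H146 : MSVecField P 𝔤 → VecField P 0 𝔤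
  u146 : MSVecField P 𝔤 → GaugeTransf P 0 G
  domB : Set (MSVecField P 𝔤)
  w148 : Plaq P 0 → ℝ
  O148 : MSVecField P 𝔤 → ℝ
  τ148 : ℝ
  /-- (1.47) -/
  T147 : MSVecField P 𝔤 → ℝ
  (C147 A₀ C₁ p₀g q₁g Rk Linv : ℝ)
  N : ℕ
  /-- (1.51) -/
  dom151 : Set (MSVecField P 𝔤)
  H151 : MSVecField P 𝔤 → VecField P 0 𝔤
  u151 : MSVecField P 𝔤 → GaugeTransf P 0 G
  /-- p. 370: the printed `Ω″_{h+1}` and the regularity predicate -/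
  Ωpph1 : Set (Site P 0)
  RegH : Set (Site P 0) → GaugeField P 0 G → Prop
  /-- (1.54) -/
  H2 : VecField P 0 𝔤 → VecField P 0 𝔤 → VecField P 0 𝔤
  Gk : VecField P 0 𝔤 → VecField P 0 𝔤
  H1k : MSVecField P 𝔤 → VecField P 0 𝔤
  J12 : VecField P 0 𝔤
  u0k : GaugeTransf P 0 G
  /-- p. 371 -/
  Λin : ∀ j, Set (PBond P j)
  εk : ℝ
  /-- (1.57)–(1.58) -/
  H157 : MSVecField P 𝔤 → VecField P 0 𝔤
  u157 : MSVecField P 𝔤 → GaugeTransf P 0 G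
  H158 : MSVecField P 𝔤 → VecField P 0 𝔤
  u158 : MSVecField P 𝔤 → GaugeTransf P 0 G
  /-- (1.59): the terms, their localized determining sets, the averaged chart -/
  T159 : Type
  Eterm : T159 → GaugeField P 0 G → 𝕜
  detJbox : T159 → DetSet P
  Qd : VecField P 0 𝔤 → MSVecField P 𝔤
  /-- (1.61)–(1.63) -/
  detPPY1 : DetSet P
  (Y1 Y10 : Set (Site P 0))
  W161 : MSField P G
  detB1Y2 : DetSet P
  (Y2 Y20 : Set (Site P 0))
  W162 : MSField P G
  detKY3 : DetSet P
  (Y3 Y30 : Set (Site P 0))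
  W163 : MSField P G
  /-- (1.64) -/
  Vk : MSField P G
  /-- p. 372 -/
  S372 : LocDomainSys
  dom372 : S372.Dom → Set Φ
  T372 : S372.Dom → Φ → ℂ
  (c372 κ372 : ℝ)
  /-- (1.65) and p. 375 -/
  U0k : Φ₁ → Φ₂
  S₄ : Set Φ₁
  S₁ : Set Φ₂
  TE : Type
  domE : TE → Set Φ₂
  /-- (1.66)–(1.67), one term -/
  (T166 A166 β κ djX dkY₀ δ dist κ₁ Minvd dkZ : ℝ)
  vol : ℕ → ℝ
  /-- pp. 376–377: the γ-FAMILY of situations (a run with couplings in `]0, γOf i]` at one of its steps, with ITS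
  `𝐃_k`, `d_k`, `d_{k,Z}` = `Sγ i : B16.RelDomainSys`, ITS component predicate «Y is a component of Z˜», analyticity domains
  and terms `V(Y, ·)` of (1.68)–(1.69)), and the member `i₀` = THIS run at THIS step — so that (1.68), (1.69), the
  exceptional terms and the α-clause speak about the same objects -/
  ιγ : Type
  γOf : ιγ → ℝ
  Sγ : ιγ → B16.RelDomainSys
  insideγ : ∀ i, (Sγ i).Dom → Prop
  domγ : ∀ i, (Sγ i).Dom → Set Φ
  Vγ : ∀ i, (Sγ i).Dom → Φ → ℂ
  i₀ : ιγ
  /-- at `i₀`: the relation «Y₀∖Z = Y∖Z ≠ ∅», the resummed exceptional sums, their constant; the α of (1.68); the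
  old-determining-set count `Σ_j |Γ⁰_j ∩ Y|` and the O(1) of (1.69) -/
  SameOffZ : (Sγ i₀).Dom → (Sγ i₀).Dom → Prop
  Texc : (Sγ i₀).Dom → Φ → ℂ
  c' : ℝ
  α168 : ℝ
  lfCubes : (Sγ i₀).Dom → ℕ
  C169 : ℝ
  /-- (1.70): the letters of `B16Eq170Assembly.Eq170` -/
  (pref χh A1 : ℝ)
  μV : MeasureTheory.Measure ΩV
  AV : ΩV → ℝ
  μN : MeasureTheory.Measure ΩN
  App : ΩN → ℝ
  (Apk dg σ₀ : ℝ)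
  nBT : ℕ
  (EkZ EkΛ : ℝ)
  μNB : MeasureTheory.Measure ΩNB
  (wN Q121 Ah2 SV : ΩNB → ℝ)
  /-- p. 378 -/
  Comp : Type
  FirstClass : Comp → Prop
  plaqs : Comp → Set (Plaq P E.k)
  bonds : Comp → Set (PBond P E.k)
  pdev : Plaq P E.k → ℝ
  bdev : PBond P E.k → ℝ
  (C183 M₀ : ℝ)
  /-- (1.72) -/
  R172 : B16Cor3Ops.Repr172 Cfg Dom
  Rρ : Cfg → ℝ
  /-- p. 379: the letters of `σ` -/
  (σ₁ σ₂ C379 C379' A₁ p₁g cardB₀ αsum C₀ q₀g : ℝ)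

/-- **BLOCK 39 HYPOTHESIS BUNDLE — [Balaban1989LargeFieldII] pp. 367–379, displays (1.40)–(1.72): the block's printed
statements, each the in-tree typed statement BY NAME or §1's hypothesis-form residual, in page order, over ONE record of
carriers `𝔩 : Letters …`.**  Fields: `eq142` ((1.42)), `eq144` ((1.44), every `j ≤ k`),
`ineq145` ((1.45) on the j-th domains, every `j ≤ k`, every `𝐔` of the domain), `small184U0`, `ext187A0` (p. 367 l. 22–28),
`repr146` ((1.46)), `ineq147` ((1.47)), `eq148` ((1.48) with its «terms in O(1) are small»), `repr151` ((1.51)), `reg153`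
(p. 370), `repr154` ((1.54)), `small156` (p. 371), `eq157a`, `repr157` ((1.57)), `repr158` ((1.58)), `eq159` ((1.59) for every
term and every small `B`), `repro161`∕`repr161`, `repro162`∕`repr162`, `repro163`∕`repr163` ((1.61)–(1.63)), `eq164` ((1.64)),
`loc372` (p. 372), `stmt165` ((1.65)), `dom165` (p. 375), `factor166`, `extract166`, `exc376` (p. 376), `ineq168` ((1.68)),
`alpha168` (its clause), `ineq169` ((1.69)), `eq170` ((1.70)), `smallField378` (p. 378), `repr172` ((1.72)), `sigmaQuad`,
`sigmaV` (p. 379).  The PROVED rows of the block ((1.40)⇔ and its solution sentence with (1.41), (1.43), (1.49), (1.50),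
(1.52), (1.55), (1.60), (1.64)⇐, p. 376
l. 2–6, (1.66) extraction ⇐ geometry, (1.70) ⇐ (1.49)) are theorems of the tree and therefore not hypotheses (module
docstring table).  A consumer takes `(h : Hyp 𝔩)` and uses the fields and §3.  Nothing is asserted.
[cite: Balaban1989LargeFieldII, (1.40)-(1.72) pp.367-379] -/
structure Hyp {P : Params} {G : Type*} [GaugeGroup G] {av : ∀ i, Averaging P i G} {𝔤 : Type*} [AddCommGroup 𝔤]
    [Module ℝ 𝔤] {𝕜 : Type*} [AddCommGroup 𝕜] {Φ₁ Φ₂ : Type*} [NormedAddCommGroup Φ₁] [NormedSpace ℂ Φ₁]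
    [NormedAddCommGroup Φ₂] [NormedSpace ℂ Φ₂] {Φ Cfg Dom ΩV ΩN ΩNB : Type*} [MeasurableSpace ΩV] [MeasurableSpace ΩN]
    [MeasurableSpace ΩNB] (𝔩 : Letters P G av 𝔤 𝕜 Φ₁ Φ₂ Φ Cfg Dom ΩV ΩN ΩNB) : Prop where
  /-- **(1.42)** p. 367 — `B16Sect1AnalyticExt.ExtData.Eq142`. [cite: Balaban1989LargeFieldII, (1.42) p.367] -/
  eq142 : 𝔩.E.Eq142 𝔩.BΛ142
  /-- **(1.44)** p. 367, for `j = 0, 1, …, k` — `ExtData.Eq144`. [cite: Balaban1989LargeFieldII, (1.44) p.367] -/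
  eq144 : ∀ j ≤ 𝔩.E.k, 𝔩.E.Eq144 j (𝔩.Mtj j) 𝔩.UkZp
  /-- **(1.45)** p. 367: *«|Ṽ_{j,Z}(V′) − 1| ≦ O(1)B₃B₅M⁵|log V′|»* on the j-th domain of 𝐁_k(Z), `j ≤ k`, at `V′ = M̃^k(U′)` for
  every `𝐔 = U′U` of the domain — `B16Sect1Statements.Ineq145` at the sizes `devj j (Ṽ_{j,Z}(M̃^k(U′)))`, `nlog (M̃^k(U′))`.
  [cite: Balaban1989LargeFieldII, (1.45) p.367] -/
  ineq145 : ∀ j ≤ 𝔩.E.k, ∀ UU ∈ 𝔩.E.dom,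
    B16Sect1Statements.Ineq145
      (𝔩.devj j (𝔩.E.Vt144 (𝔩.Mtj j) 𝔩.UkZp (fun W => 𝔩.E.VΛ' W (𝔩.E.Mk UU.2)) (𝔩.E.Mt UU.1)))
      𝔩.C145 𝔩.B₃ 𝔩.B₅ 𝔩.M (𝔩.nlog (𝔩.E.Mt UU.1))
  /-- **p. 367 l. 24–25** — `Small184MjU0Printed` (§1). [cite: Balaban1989LargeFieldII, p.367 (after (1.45))] -/
  small184U0 : Small184MjU0Printed 𝔩.E 𝔩.Λbj 𝔩.szG 𝔩.C184 𝔩.B₃ 𝔩.B₅ 𝔩.M 𝔩.α₀k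
  /-- **p. 367 l. 26–28** — `Ext187A0Printed` (§1). [cite: Balaban1989LargeFieldII, p.367 (after (1.45))] -/
  ext187A0 : Ext187A0Printed 𝔩.E 𝔩.HkΛ 𝔩.a 𝔩.da 𝔩.dda 𝔩.IsAnalyticA0 𝔩.C187 𝔩.B₃ 𝔩.B₅ 𝔩.M 𝔩.α₀k 𝔩.α₁k
  /-- **(1.46)** p. 368, for every small `B` — `B16Sect1WilsonTerms.Sect1Data.Repr146`. [cite: Balaban1989LargeFieldII, (1.46) p.368] -/
  repr146 : ∀ B ∈ 𝔩.domB,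
    B16Sect1WilsonTerms.Sect1Data.Repr146 𝔩.D 𝔩.detPPZh2 𝔩.Zpph2 𝔩.Ad 𝔩.Qt 𝔩.𝔸₀ B 𝔩.H146 𝔩.u146
  /-- **(1.47)** p. 368, the final bound on the most dangerous term — `B16Sect1Statements.Ineq147`.
  [cite: Balaban1989LargeFieldII, (1.47) p.368] -/
  ineq147 : ∀ B ∈ 𝔩.domB,
    B16Sect1Statements.Ineq147 (𝔩.T147 B) 𝔩.C147 𝔩.A₀ 𝔩.C₁ 𝔩.B₃ 𝔩.B₅ 𝔩.M 𝔩.p₀g 𝔩.q₁g 𝔩.Rk 𝔩.Linv 𝔩.N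
  /-- **(1.48)** p. 368 — `B16Sect1WilsonTerms.Sect1Data.Eq148` at the two configurations of (1.46), *«where the terms in O(1)
  are small»* (`|O148 B| ≤ τ148`). [cite: Balaban1989LargeFieldII, (1.48) p.368] -/
  eq148 : ∀ B ∈ 𝔩.domB,
    B16Sect1WilsonTerms.Sect1Data.Eq148 𝔩.w148
        (B16Sect1WilsonTerms.Sect1Data.cfgH2 𝔩.D 𝔩.detPPZh2 𝔩.Zpph2
          (B16Sect1WilsonTerms.Sect1Data.datum146 𝔩.D 𝔩.Qt 𝔩.𝔸₀ B))
        (B16Sect1WilsonTerms.Sect1Data.cfgH2 𝔩.D 𝔩.detPPZh2 𝔩.Zpph2 (B16Sect1WilsonTerms.Sect1Data.expB146 𝔩.D B))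
        (𝔩.O148 B) ∧
      |𝔩.O148 B| ≤ 𝔩.τ148
  /-- **(1.51)** p. 370 — `B16Sect1Backgrounds.Sect1Data.Repr151`. [cite: Balaban1989LargeFieldII, (1.51) p.370] -/
  repr151 : 𝔩.D.Repr151 𝔩.dom151 𝔩.H151 𝔩.u151
  /-- **p. 370 after (1.53)** — `Regular153U12Printed` (§1). [cite: Balaban1989LargeFieldII, p.370 (after (1.53))] -/
  reg153 : Regular153U12Printed 𝔩.D 𝔩.Ωpph1 𝔩.RegH
  /-- **(1.54)** p. 370 — `Sect1Data.Repr154`. [cite: Balaban1989LargeFieldII, (1.54) p.370] -/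
  repr154 : 𝔩.D.Repr154 𝔩.H2 𝔩.Gk 𝔩.H1k 𝔩.J12 𝔩.Qt 𝔩.𝔸₀ 𝔩.u0k
  /-- **p. 371 after (1.56)** — `Small184UkΛPrinted` (§1). [cite: Balaban1989LargeFieldII, p.371 (after (1.56))] -/
  small156 : Small184UkΛPrinted 𝔩.D 𝔩.Λin 𝔩.szG 𝔩.C184 𝔩.B₃ 𝔩.B₅ 𝔩.M 𝔩.εk
  /-- **(1.57), first member** p. 371 — `Sect1Data.Eq157a`. [cite: Balaban1989LargeFieldII, (1.57) p.371] -/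
  eq157a : 𝔩.D.Eq157a
  /-- **(1.57), second member** p. 371 — `Sect1Data.Repr157`. [cite: Balaban1989LargeFieldII, (1.57) p.371] -/
  repr157 : 𝔩.D.Repr157 𝔩.H157 𝔩.u157
  /-- **(1.58), second member** p. 371 — `Sect1Data.Repr158` (the first member is PROVED, `eq158a`).
  [cite: Balaban1989LargeFieldII, (1.58) p.371] -/
  repr158 : 𝔩.D.Repr158 𝔩.H158 𝔩.u158
  /-- **(1.59)** p. 372, for every term and every small `B` — `B16Sect1AnalyticExt.Sect1Data.Eq159` (with the representing
  function `𝐇″_k` of (1.51)). [cite: Balaban1989LargeFieldII, (1.59) p.372] -/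
  eq159 : ∀ t : 𝔩.T159, ∀ B ∈ 𝔩.dom151,
    B16Sect1AnalyticExt.Sect1Data.Eq159 𝔩.D (𝔩.Eterm t) (𝔩.detJbox t) 𝔩.Qd 𝔩.H151 B
  /-- **(1.61), first member** p. 373 — `Sect1Data.Repro161`. [cite: Balaban1989LargeFieldII, (1.61) p.373] -/
  repro161 : B16Sect1AnalyticExt.Sect1Data.Repro161 𝔩.D 𝔩.detPPY1
  /-- **(1.61), second member** p. 373 (printed «(1.161)») — `Sect1Data.Repr161`. [cite: Balaban1989LargeFieldII, (1.61) p.373] -/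
  repr161 : B16Sect1AnalyticExt.Sect1Data.Repr161 𝔩.D 𝔩.detPPY1 𝔩.Y1 𝔩.Y10 𝔩.W161
  /-- **(1.62), first member** p. 373 — `Sect1Data.Repro162`. [cite: Balaban1989LargeFieldII, (1.62) p.373] -/
  repro162 : B16Sect1AnalyticExt.Sect1Data.Repro162 𝔩.D 𝔩.detB1Y2
  /-- **(1.62), second member** p. 373 — `Sect1Data.Repr162`. [cite: Balaban1989LargeFieldII, (1.62) p.373] -/
  repr162 : B16Sect1AnalyticExt.Sect1Data.Repr162 𝔩.D 𝔩.detB1Y2 𝔩.Y2 𝔩.Y20 𝔩.W162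
  /-- **(1.63), first member** p. 374 — `Sect1Data.Repro163`. [cite: Balaban1989LargeFieldII, (1.63) p.374] -/
  repro163 : B16Sect1AnalyticExt.Sect1Data.Repro163 𝔩.D 𝔩.detKY3
  /-- **(1.63), second member** p. 374 — `Sect1Data.Repr163`. [cite: Balaban1989LargeFieldII, (1.63) p.374] -/
  repr163 : B16Sect1AnalyticExt.Sect1Data.Repr163 𝔩.D 𝔩.detKY3 𝔩.Y3 𝔩.Y30 𝔩.W163
  /-- **(1.64)** p. 374 — `Sect1Data.Eq164` for `𝐇_k = H158`. [cite: Balaban1989LargeFieldII, (1.64) p.374] -/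
  eq164 : B16Sect1AnalyticExt.Sect1Data.Eq164 𝔩.D 𝔩.H158 𝔩.Vk
  /-- **p. 372** — `LocTerms372Printed` (§1). [cite: Balaban1989LargeFieldII, p.372 (after (1.60))] -/
  loc372 : LocTerms372Printed 𝔩.S372 𝔩.dom372 𝔩.T372 𝔩.c372 𝔩.κ372
  /-- **(1.65)** p. 375, the full sentence — `B16Eq165Descent.Statement165`. [cite: Balaban1989LargeFieldII, (1.65) p.375] -/
  stmt165 : B16Eq165Descent.Statement165 𝔩.U0k 𝔩.S₄ 𝔩.S₁
  /-- **p. 375 after (1.65)**: *«the space Ũ″ᶜ_k(Y₁, α̃₀, α̃₁) is contained in the analyticity domain of the term 𝐄(X) we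
  consider, hence in the analyticity domains of all terms in the obtained effective action»*.
  [cite: Balaban1989LargeFieldII, p.375 (after (1.65))] -/
  dom165 : ∀ X : 𝔩.TE, 𝔩.S₁ ⊆ 𝔩.domE X
  /-- **p. 376, the sentence of (1.66)** — `Factor166Printed` (§1). [cite: Balaban1989LargeFieldII, (1.66) p.376] -/
  factor166 : Factor166Printed 𝔩.T166 𝔩.A166 𝔩.β 𝔩.κ 𝔩.djX 𝔩.dkY₀ 𝔩.δ 𝔩.dist 𝔩.κ₁ 𝔩.Minvd 𝔩.vol
  /-- **p. 376, the extraction** — `Extract166Printed` (§1). [cite: Balaban1989LargeFieldII, (1.66)-(1.67) p.376] -/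
  extract166 : Extract166Printed 𝔩.β 𝔩.κ 𝔩.djX 𝔩.dkY₀ 𝔩.δ 𝔩.dist 𝔩.κ₁ 𝔩.Minvd 𝔩.dkZ 𝔩.vol
  /-- **pp. 376–377, the exceptional terms** — `Exceptional376Printed` (§1). [cite: Balaban1989LargeFieldII, pp.376-377 (after (1.67))] -/
  exc376 : Exceptional376Printed (𝔩.Sγ 𝔩.i₀) 𝔩.SameOffZ (𝔩.domγ 𝔩.i₀) 𝔩.Texc 𝔩.c' 𝔩.β 𝔩.κ
  /-- **(1.68)** p. 377 — `B16.Ineq168`. [cite: Balaban1989LargeFieldII, (1.68) p.377] -/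
  ineq168 : B16.Ineq168 (𝔩.Sγ 𝔩.i₀) (𝔩.insideγ 𝔩.i₀) (𝔩.domγ 𝔩.i₀) (𝔩.Vγ 𝔩.i₀) 𝔩.α168 𝔩.β 𝔩.κ
  /-- **(1.68)'s clause** p. 377 — `Alpha168ClausePrinted` (§1) over the γ-family of which THIS step is the member `i₀`
  (so `alpha168` at `i₀` re-delivers (1.68) with any prescribed `α` once `0 < γOf i₀ ≤ γ₀(α)`: §3 `Hyp.ineq168_small`).
  [cite: Balaban1989LargeFieldII, (1.68) p.377] -/
  alpha168 : Alpha168ClausePrinted 𝔩.γOf 𝔩.Sγ 𝔩.insideγ 𝔩.domγ 𝔩.Vγ 𝔩.β 𝔩.κ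
  /-- **(1.69)** p. 377 — `B16.Ineq169`. [cite: Balaban1989LargeFieldII, (1.69) p.377] -/
  ineq169 : B16.Ineq169 (𝔩.Sγ 𝔩.i₀) (𝔩.insideγ 𝔩.i₀) (𝔩.domγ 𝔩.i₀) (𝔩.Vγ 𝔩.i₀) 𝔩.lfCubes 𝔩.C169
  /-- **(1.70)** p. 377 — `B16Eq170Assembly.Eq170`. [cite: Balaban1989LargeFieldII, (1.70) p.377] -/
  eq170 : B16Eq170Assembly.Eq170 𝔩.pref 𝔩.χh 𝔩.D.gk 𝔩.A1 𝔩.μV 𝔩.AV 𝔩.μN 𝔩.App 𝔩.Apk 𝔩.dg 𝔩.σ₀ 𝔩.nBT 𝔩.EkZ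
    𝔩.EkΛ 𝔩.μNB 𝔩.wN 𝔩.Q121 𝔩.Ah2 𝔩.SV
  /-- **p. 378** — `SmallField378Printed` (§1). [cite: Balaban1989LargeFieldII, p.378] -/
  smallField378 : SmallField378Printed 𝔩.FirstClass 𝔩.E.k 𝔩.plaqs 𝔩.bonds 𝔩.pdev 𝔩.bdev 𝔩.εk 𝔩.C183 𝔩.B₅ 𝔩.M 𝔩.M₀
  /-- **(1.72)** p. 379: the 𝐑-operation formula HOLDS for the density `𝐑ρ_k` — `B16Cor3Ops.Repr172.Holds`.
  [cite: Balaban1989LargeFieldII, (1.72) p.379] -/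
  repr172 : 𝔩.R172.Holds 𝔩.Rρ
  /-- **p. 379, the first-order term of the quadratic form** — `B16Sect1Statements.SigmaQuad379`.
  [cite: Balaban1989LargeFieldII, p.379 (after (1.72))] -/
  sigmaQuad : B16Sect1Statements.SigmaQuad379 𝔩.σ₁ 𝔩.C379 𝔩.B₃ 𝔩.A₁ 𝔩.p₁g 𝔩.cardB₀ 𝔩.αsum
  /-- **p. 379, the first-order term of `V(X˜)`** — `B16Sect1Statements.SigmaV379`. [cite: Balaban1989LargeFieldII, p.379 (after (1.72))] -/
  sigmaV : B16Sect1Statements.SigmaV379 𝔩.σ₂ 𝔩.C379' 𝔩.B₃ 𝔩.A₁ 𝔩.C₀ 𝔩.M 𝔩.Rk 𝔩.p₁g 𝔩.q₀g 𝔩.D.gk 𝔩.d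

/-! ## §3  Kernel-checked bookkeeping out of the bundle (no statement asserted) -/

/-- The residual `Extract166Printed` IS the conclusion of the tree's conditional theorem: given the geometric input of p. 376
(«Y₄∖Z = (Y₀∖Z) ∪ ⋃(Y′_i∖Z)» — the relative tree length `d_{k,Z}(Y₄)` is paid by `d_k(Y₀)`, half the distance term and half the
volume terms; hypothesis `hext`, cell GAPS G-B16-05), the extraction holds (`B16Sect1Statements.factor166_le_extract`).
[cite: Balaban1989LargeFieldII, (1.66)-(1.67) p.376 (bookkeeping)] -/
theorem extract166_of_geom {β κ djX dkY₀ δ dist κ₁ Minvd dkZ : ℝ} {vol : ℕ → ℝ}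
    (hext : (1 + 3 * β) * κ * dkZ ≤ (1 + 3 * β) * κ * dkY₀ + 1 / 2 * δ * dist +
      ∑ i ∈ Finset.Icc 2 4, 1 / 2 * (κ₁ - 1) * Minvd * vol i) :
    Extract166Printed β κ djX dkY₀ δ dist κ₁ Minvd dkZ vol :=
  B16Sect1Statements.factor166_le_extract hext

section Bookkeeping

variable {P : Params} {G : Type*} [GaugeGroup G] {av : ∀ i, Averaging P i G} {𝔤 : Type*} [AddCommGroup 𝔤]
  [Module ℝ 𝔤] {𝕜 : Type*} [AddCommGroup 𝕜] {Φ₁ Φ₂ : Type*} [NormedAddCommGroup Φ₁] [NormedSpace ℂ Φ₁]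
  [NormedAddCommGroup Φ₂] [NormedSpace ℂ Φ₂] {Φ Cfg Dom ΩV ΩN ΩNB : Type*} [MeasurableSpace ΩV] [MeasurableSpace ΩN]
  [MeasurableSpace ΩNB]

/-- **(1.48), positivity of the main term** over the block's letters: for a nonnegative weight `(1/(g″_k(·))²)ζ₁` the Wilson
action of the G-valued configuration `U″_{h+2}(exp ig_kB, V″)` is `≥ 0` — *«hence the action is positive, and it provides the
necessary bounds for large plaquette variables»* (`B16Sect1WilsonTerms.Sect1Data.eq148_main_nonneg`, i.e. the tree's
`B16Sect1Wilson.wilsonLoc_nonneg`; no hypothesis of the bundle is needed). [cite: Balaban1989LargeFieldII, (1.48) p.368 (bookkeeping)] -/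
theorem Letters.eq148_main_nonneg (𝔩 : Letters P G av 𝔤 𝕜 Φ₁ Φ₂ Φ Cfg Dom ΩV ΩN ΩNB) (hw : ∀ p, 0 ≤ 𝔩.w148 p)
    (B : MSVecField P 𝔤) :
    0 ≤ B16Sect1Wilson.wilsonLoc 𝔩.w148
      (B16Sect1WilsonTerms.Sect1Data.cfgH2 𝔩.D 𝔩.detPPZh2 𝔩.Zpph2 (B16Sect1WilsonTerms.Sect1Data.expB146 𝔩.D B)) :=
  B16Sect1WilsonTerms.Sect1Data.eq148_main_nonneg 𝔩.D 𝔩.w148 hw _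

variable {𝔩 : Letters P G av 𝔤 𝕜 Φ₁ Φ₂ Φ Cfg Dom ΩV ΩN ΩNB}

/-- **(1.60) out of the bundle** (row B16.Eq1.60, PROVED in the tree from (1.51)): for every gauge-invariant term
`𝐄^{(j)}(X, ·, z)` and every small `B`, *«𝐄^{(j)}(X, U″_k, z) = 𝐄^{(j)}(X, U⁰_k, z) + [𝐄^{(j)}(X, exp iη𝐇″_k(g_kB)U⁰_k, z) −
𝐄^{(j)}(X, U⁰_k, z)]»* — from the field `repr151` by `B16Sect1Backgrounds.Sect1Data.eq160`.
[cite: Balaban1989LargeFieldII, (1.60) p.372 (bookkeeping)] -/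
theorem Hyp.eq160 (h : Hyp 𝔩) {𝕜' : Type*} [AddCommGroup 𝕜'] (E : GaugeField P 0 G → 𝕜') (hE : GaugeInvariant E)
    {B : MSVecField P 𝔤} (hB : B ∈ 𝔩.dom151) :
    E (𝔩.D.cfg150 B) = E 𝔩.D.bg0k + (E (expMul 𝔩.D.ch (𝔩.D.η • 𝔩.H151 (𝔩.D.gk • B)) 𝔩.D.bg0k) - E 𝔩.D.bg0k) :=
  𝔩.D.eq160 E hE h.repr151 hB

/-- **(1.59) re-derived from the bundle's (1.51) and the printed inputs of the tree's `eq159_of`** — so the field `eq159` is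
what the paper derives, not an independent assumption: given the □₀-localized form of a term (`hloc`, *«a somewhat simplified
version of the transformation (3.3), (3.18), (3.19) [I]»*), the averaged chart identity of [12] (26) at `U⁰_k` (`h26`), the
gauge covariances of the averages [12] (11) (`hM`) and of the solution map [15] (181) (`hU`), and gauge invariance of the term
(`hE`), (1.59) holds at every `B` of the (1.51)-domain, with the representing function `𝐇″_k = H151` of the field `repr151`.
[cite: Balaban1989LargeFieldII, (1.59) p.372 (bookkeeping)] -/
theorem Hyp.eq159_of_inputs (h : Hyp 𝔩) {𝕜' : Type*} [AddCommGroup 𝕜'] {E : GaugeField P 0 G → 𝕜'} {detJbox : DetSet P}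
    {ubar : GaugeTransf P 0 G → GaugeTransf P 0 G}
    (hloc : ∀ U, E U = E (𝔩.D.bg.U detJbox (avgFamily av U)))
    (h26 : ∀ A : VecField P 0 𝔤,
      avgFamily av (expMul 𝔩.D.ch A 𝔩.D.bg0k) = msExpMul 𝔩.D.ch (𝔩.Qd A) (avgFamily av 𝔩.D.bg0k))
    (hM : ∀ (v : GaugeTransf P 0 G) (U : GaugeField P 0 G),
      avgFamily av (gaugeAct v U) = msGaugeAct (toMS v) (avgFamily av U))
    (hU : ∀ (v : GaugeTransf P 0 G) (V : MSField P G),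
      𝔩.D.bg.U detJbox (msGaugeAct (toMS v) V) = gaugeAct (ubar v) (𝔩.D.bg.U detJbox V))
    (hE : GaugeInvariant E) {B : MSVecField P 𝔤} (hB : B ∈ 𝔩.dom151) :
    B16Sect1AnalyticExt.Sect1Data.Eq159 𝔩.D E detJbox 𝔩.Qd 𝔩.H151 B :=
  B16Sect1AnalyticExt.Sect1Data.eq159_of 𝔩.D hloc h.repr151 h26 hM hU hE hB

/-- **p. 375's «basic fact» out of the bundle**: *«This implies the basic fact that the function 𝐄(X, U⁰_k) is an analytic
function of the variables (𝐔, 𝐉) on the space Ũᶜ_k(Y₄, α̃₀, α̃₁)»* — from `stmt165` ((1.65) with the analyticity of `U⁰_k`)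
and `dom165` (the inclusion), for every term `X` analytic on its domain (`hE`, the inductive assumption (1.70) [IV] for the
term), by `B16Eq165Descent.analyticOnNhd_comp_of_statement165`. [cite: Balaban1989LargeFieldII, (1.65) p.375 (bookkeeping)] -/
theorem Hyp.analytic_term (h : Hyp 𝔩) {W : Type*} [NormedAddCommGroup W] [NormedSpace ℂ W] (X : 𝔩.TE) {E : Φ₂ → W}
    (hE : AnalyticOnNhd ℂ E (𝔩.domE X)) : AnalyticOnNhd ℂ (E ∘ 𝔩.U0k) 𝔩.S₄ :=
  B16Eq165Descent.analyticOnNhd_comp_of_statement165 h.stmt165 (h.dom165 X) hE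

/-- **(1.68) with a prescribed constant out of the bundle** — the α-clause AT THIS STEP: for every `α > 0` there is
`γ₀ > 0` such that, if the run's coupling bound `γOf i₀` lies in `]0, γ₀]`, the resummed terms of this step satisfy (1.68)
with that `α` (`alpha168` specialised to the member `i₀`; the field `ineq168` is the instance at the run's own `α168`).
[cite: Balaban1989LargeFieldII, (1.68) p.377 (bookkeeping)] -/
theorem Hyp.ineq168_small (h : Hyp 𝔩) {α : ℝ} (hα : 0 < α) :
    ∃ γ₀ : ℝ, 0 < γ₀ ∧ (0 < 𝔩.γOf 𝔩.i₀ → 𝔩.γOf 𝔩.i₀ ≤ γ₀ →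
      B16.Ineq168 (𝔩.Sγ 𝔩.i₀) (𝔩.insideγ 𝔩.i₀) (𝔩.domγ 𝔩.i₀) (𝔩.Vγ 𝔩.i₀) α 𝔩.β 𝔩.κ) := by
  obtain ⟨γ₀, hγ₀, H⟩ := h.alpha168 α hα
  exact ⟨γ₀, hγ₀, H 𝔩.i₀⟩

/-- **p. 379's second inequality out of the bundle**: from `sigmaQuad` (*«O(1)B₃²A₁²p₁²(g_k)|𝐁₀|(α_{0,k} + α_{1,k})»*) and the
[III] §2 inputs `|𝐁₀| ≦ (100MR_k)^dN²`, `N ≦ R_k`, `α_{0,k} + α_{1,k} ≦ C₀g_kq₀(g_k)` the printed *«< O(1)B₃²A₁²C₀M^dR_k^{d+2}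
p₁²(g_k)q₀(g_k)g_k»* with `O(1) = C·100^d` (`B16Sect1Statements.sigmaQuad379_arith`).
[cite: Balaban1989LargeFieldII, p.379 (after (1.72)) (bookkeeping)] -/
theorem Hyp.sigmaQuad_chain (h : Hyp 𝔩) {N : ℕ} (hC : 0 ≤ 𝔩.C379) (hM : 0 ≤ 𝔩.M) (hRk : 0 ≤ 𝔩.Rk) (hα : 0 ≤ 𝔩.αsum)
    (hB₀ : 𝔩.cardB₀ ≤ (100 * 𝔩.M * 𝔩.Rk) ^ 𝔩.d * (N : ℝ) ^ 2) (hN : B16Sect1Kernels.NWindowUpper N 𝔩.Rk)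
    (hαC : 𝔩.αsum ≤ 𝔩.C₀ * 𝔩.D.gk * 𝔩.q₀g) :
    |𝔩.σ₁| ≤ (𝔩.C379 * 100 ^ 𝔩.d) * 𝔩.B₃ ^ 2 * 𝔩.A₁ ^ 2 * 𝔩.C₀ * 𝔩.M ^ 𝔩.d * 𝔩.Rk ^ (𝔩.d + 2) *
      𝔩.p₁g ^ 2 * 𝔩.q₀g * 𝔩.D.gk :=
  h.sigmaQuad.trans (B16Sect1Statements.sigmaQuad379_arith hC hM hRk hα hB₀ hN hαC)

end Bookkeeping

end Literature.MathematicalPhysics.QuantumFieldTheory.Balaban1983to89.B16Carve39ExponentiationRHyp
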